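/-
Copyright (c) 2026 the pub-hodgecm-mathlib formalisation cell (harness21).  Prover seat hodgecm-mathlib-K2E3-p14 (g6), Track B «K2-LIT» ∕ h413
(`stmt-HodgeConjecture-24833`), line `K2_E3_EllipticInputs`, road (11-3-split-nsc), leaf (nsc-S-A′) «principal-block standard span», brick A1 (F-GL):
AN IRREDUCIBLE SMOOTH REPRESENTATION OF `GL_N(F)` WITH NON-ZERO BOREL JACQUET MODULE EMBEDS INTO A PRINCIPAL SERIES `parabolicIndGL F id (𝟙 ⊗ χ)`.  2026-09-04.
-/
import Literature.NumberTheory.Automorphic.JacquetNonzeroEmbedsNormalizedInd      -- ★ Frobenius core (abelian Levi) `exists_character_quotient_injective_intertwiningMap_normalizedInd`, `countable_quotient_of_isOpen_of_secondCountableTopology`, `deltaChar_eq_one_of_isLimitOfCompactOpen`, `rootDeltaChar_eq_one_of_mem_of_isClosed_of_isCompact`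
import Literature.NumberTheory.Automorphic.UnipotentRadicalCompactOpenProofs       -- ★ `isLimitOfCompactOpen_parabolicTripleGL_N`
import Literature.NumberTheory.Automorphic.ParabolicGLProofs                       -- ★ `exists_isCompact_isOpen_forall_standardParabolicGL_mul` (`GL_N = P_c · K₀`)
import Literature.NumberTheory.Automorphic.ParabolicSemidirect                     -- ★ `continuous_leviEmbeddingP`
import Literature.NumberTheory.Automorphic.SmoothInductionExactProofs              -- ★ `smoothIndMap`, `smoothIndMap_injective` (functoriality of `smoothIndRep`)
import Literature.NumberTheory.Automorphic.IrreducibleClassesConstituents          -- ★ `IrrClass.IsConstituentOf.of_injective`, `isConstituentOf_mk_self`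
import Summits.HodgeConjecture.HodgeConjecture.Theorems.K2E3GLnIntegerPointsHaarVsAddHaar   -- ★ `secondCountableTopology_gl` (reused, not restated)
import HarnessLib

/-!
# K2_E3 road (h413), (11-3-split-nsc) leaf (nsc-S-A′), brick A1 (F-GL) — the principal block of `GL_N(F)` embeds into the principal series

Cell `pub/hodgecm-mathlib` (D-0151), Track B, seat K2E3-p14 (g6); dealer K2E3-plan (g3) DEAL 2026-09-04 08:14:42Z, road owner K2E3-p11 (g6)
(BRICK LIST v2).  `--supports stmt-HodgeConjecture-24833 --as helper`; THEOREMS ONLY (no definition ∕ instance ∕ notation ∕ named fact ∕ `sorry`); never imports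
`Cruxes/…/Lines`.  COUNT-NEUTRAL.

THE MATHEMATICS ([BernsteinZelevinsky1977, Prop. 1.9 (b), §2.3, proof of Thm. 2.5]; [Casselman1995, Thm. 3.2.4, §6.3]; [Rogawski1990, §12.1 pp. 171–172]:
«if `π_N ≠ 0`, `π` is a subrepresentation of some `i_G(χ)`»).  `F` a non-archimedean local field, `G = GL_N(F)`, `B = T U` the standard Borel
(`standardParabolicGL F id`, `T` the diagonal torus `standardLeviGL F id ≅ (F^×)^N`, `U` the upper unitriangular group).  For an irreducible smooth
`π` with `π_U ≠ 0`: `G = B · GL_N(𝒪)` (Iwasawa, ★), `δ_B|_U = 1` (`U` is a union of compact open subgroups, ★), `T` is ABELIAN, `G` is second countable;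
so the Frobenius core ★ `Representation.exists_character_quotient_injective_intertwiningMap_normalizedInd` gives a character `χ` of `T` that is a QUOTIENT of
the normalised Jacquet module `r_B(π)` and an injective `G`-map `π ↪ i_B^G(ℂ_χ) = normalizedInd (parabolicTripleGL F id) (𝟙 ⊗ χ)`.  This file (i) discharges
the four hypotheses for `GL_N(F)`, (ii) shows `χ` has OPEN KERNEL (it is a quotient character of a SMOOTH representation of `T`), (iii) transports the
embedding to the tree's `GL_N` functor `Representation.parabolicIndGL F id (𝟙 ⊗ χ′)`, `χ′ = χ ∘ (leviEmbedding)` — the two inductions have the same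
carrier subgroup `B` and inducing characters that agree because the abstract Levi projection of `parabolicTripleGL F c` IS `leviEmbedding ∘ leviProjection`
(`coe_proj_parabolicTripleGL`) — and (iv) records the two consequences the leaf (nsc-S-A′) consumes: `π` is ADMISSIBLE and its class is a CONSTITUENT of
the principal series `parabolicIndGL F id (𝟙 ⊗ χ′)`.

* §1 `coe_proj_parabolicTripleGL` — `((parabolicTripleGL F c).proj p : GL_n) = leviEmbedding c (leviProjection c p)` (every ring, every labelling);
* §2 the Borel data of `GL_N(F)`: `levi_id_mul_comm` ∕ `standardLeviGL_id_mul_comm` (the torus is abelian), `countable_quotient_of_isOpen_gl`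
  (second countability, ★ `K2E3GLnIntegerPointsHaarVsAddHaar.secondCountableTopology_gl`), `exists_isCompact_isOpen_forall_parabolicTripleGL_mul` (Iwasawa in the
  Frobenius core's shape), `deltaChar_parabolicTripleGL_eq_one` (`δ_{P_c}|_{U_c} = 1`);
* §3 `isOpen_ker_of_intertwiningMap_twist_ne_zero` — a character receiving a NON-ZERO map from a smooth representation has open kernel;
  `isSmooth_normalizedJacquet_parabolicTripleGL` — `r_{P_c}(π)` is smooth for smooth `π` (any monotone `c`);
* §4 **`exists_character_injective_intertwiningMap_parabolicIndGL`** — the embedding `π ↪ parabolicIndGL F id (𝟙 ⊗ χ′)`, `χ′` with open kernel, for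
  `π` irreducible smooth with `¬ Subsingleton (restrictUnipotentGL F id π).Coinvariants`; **`isAdmissible_of_not_subsingleton_coinvariants_id`**;
  **`SmoothIrrep.exists_isConstituentOf_parabolicIndGL_id`** (class level).

HONEST LABEL: HC_CM is proved only modulo the 7 printed citations (2 remaining named inputs: hLiu418 = stmt-HodgeConjecture-24832, h413 =
stmt-HodgeConjecture-24833) until rung 0 closes; count-neutral helper toward the hosted leaf (nsc-S-A′).

## References
* [BernsteinZelevinsky1977] I. N. Bernstein, A. V. Zelevinsky, *Induced representations of reductive 𝔭-adic groups I*, Ann. Sci. ÉNS 10 (1977): Prop. 1.9 (b), §2.3, Thm. 2.5.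
* [Casselman1995] W. Casselman, *Introduction to the theory of admissible representations of p-adic reductive groups* (notes, 1995): Thm. 3.2.4, §6.3.
* [Rogawski1990] J. D. Rogawski, *Automorphic Representations of Unitary Groups in Three Variables*, Ann. of Math. Stud. 123 (1990): §12.1 pp. 171–172.
* [Bump1997] D. Bump, *Automorphic Forms and Representations* (1997): Prop. 4.5.2 (Iwasawa decomposition).
-/

set_option autoImplicit false
set_option linter.dupNamespace false

noncomputable section

open Topology TopologicalSpace Set

namespace Summit.HodgeConjecture.HodgeConjecture.Cruxes.H413.K2E3GLnPrincipalBlockEmbedding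

open Literature.NumberTheory.Automorphic

/-! ## §1 The abstract Levi projection of `parabolicTripleGL` is `leviEmbedding ∘ leviProjection` -/

section Proj

variable {R : Type*} [CommRing R] {n : Type*} [Fintype n] [DecidableEq n] {α : Type*} [LinearOrder α] [Fintype α] (c : n → α)

/-- **The Levi projection of the abstract triple `(P_c, M_c, U_c)` is the block-diagonal part**: for `p ∈ P_c`,
`((parabolicTripleGL R c).proj p : GL_n(R)) = leviEmbedding R c (leviProjection R c p)` — both are the unique `m ∈ M_c` with `m⁻¹ p ∈ U_c`
(★ `ParabolicTriple.proj_inv_mul_mem`, ★ `ParabolicTriple.eq_one_of_mem_of_mem`, ★ `leviProjection_leviEmbeddingP_apply`). [cite: BernsteinZelevinsky1977, §2.1, 1.8] -/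
theorem coe_proj_parabolicTripleGL (p : ↥(parabolicTripleGL R c).P) :
    ((parabolicTripleGL R c).proj p : GL n R) = leviEmbedding R c (leviProjection R c p) := by
  -- the block-diagonal candidate `m₀ = diag(proj p)` lies in `M_c` and `m₀⁻¹ p ∈ U_c`
  have hm₀M : leviEmbedding R c (leviProjection R c p) ∈ (parabolicTripleGL R c).M := ⟨leviProjection R c p, rfl⟩
  have hm₀N : (leviEmbedding R c (leviProjection R c p))⁻¹ * (p : GL n R) ∈ (parabolicTripleGL R c).N := by
    have h1 : (leviEmbeddingP R c (leviProjection R c p))⁻¹ * (show ↥(standardParabolicGL R c) from p) ∈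
        unipotentRadicalP R c := by
      rw [MonoidHom.mem_ker, map_mul, map_inv, leviProjection_leviEmbeddingP_apply, inv_mul_cancel]
    rw [← unipotentRadicalGL_subgroupOf, Subgroup.mem_subgroupOf] at h1
    simpa using h1
  -- uniqueness: `(proj p)⁻¹ m₀ ∈ M_c ∩ U_c = 1`
  have hq := (parabolicTripleGL R c).proj_inv_mul_mem p
  have hMN : ((((parabolicTripleGL R c).proj p : ↥(parabolicTripleGL R c).M) : GL n R))⁻¹ *
      leviEmbedding R c (leviProjection R c p) ∈ (parabolicTripleGL R c).N := by
    have := (parabolicTripleGL R c).N.mul_mem hq ((parabolicTripleGL R c).N.inv_mem hm₀N)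
    simpa [mul_assoc, mul_inv_rev] using this
  have hMM : ((((parabolicTripleGL R c).proj p : ↥(parabolicTripleGL R c).M) : GL n R))⁻¹ *
      leviEmbedding R c (leviProjection R c p) ∈ (parabolicTripleGL R c).M :=
    (parabolicTripleGL R c).M.mul_mem ((parabolicTripleGL R c).M.inv_mem ((parabolicTripleGL R c).proj p).2) hm₀M
  have h := (parabolicTripleGL R c).eq_one_of_mem_of_mem hMM hMN
  rw [inv_mul_eq_one] at h
  exact h

/-- The same identity inside `M_c`: `(parabolicTripleGL R c).proj p = ⟨leviEmbedding R c (leviProjection R c p), _⟩`, i.e. the range-restricted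
Levi embedding of the block-diagonal part. [cite: BernsteinZelevinsky1977, §2.1, 1.8] -/
theorem proj_parabolicTripleGL_eq_rangeRestrict (p : ↥(parabolicTripleGL R c).P) :
    (parabolicTripleGL R c).proj p = (leviEmbedding R c).rangeRestrict (leviProjection R c p) :=
  Subtype.ext (coe_proj_parabolicTripleGL c p)

end Proj

/-! ## §2 The Borel data of `GL_N(F)`: abelian torus, second countability, Iwasawa -/

section Torus

variable {R : Type*} [CommRing R] {N : ℕ}

/-- Each block of the Borel labelling `id : Fin N → Fin N` has exactly one index. [folklore] -/
theorem subsingleton_fiber_id (a : Fin N) : Subsingleton {i : Fin N // (id : Fin N → Fin N) i = a} :=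
  ⟨fun i j => Subtype.ext ((i.2).trans (j.2).symm)⟩

/-- **The diagonal torus `Π_a GL_1(R)` of the Borel labelling is abelian** (each block is `1 × 1`). [cite: Rogawski1990, §12.1 p. 171] -/
theorem levi_id_mul_comm (m m' : Π a : Fin N, GL {i : Fin N // (id : Fin N → Fin N) i = a} R) : m * m' = m' * m := by
  funext a
  haveI := subsingleton_fiber_id (N := N) a
  refine Units.ext (Matrix.ext fun i j => ?_)
  have hij : j = i := Subsingleton.elim j i
  subst hij
  rw [Pi.mul_apply, Pi.mul_apply, Units.val_mul, Units.val_mul, Matrix.mul_apply, Matrix.mul_apply,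
    Fintype.sum_subsingleton _ j, Fintype.sum_subsingleton _ j, mul_comm]

variable (R) in
/-- **The standard Levi `M_{id} = T` of the Borel of `GL_N(R)` is abelian** (it is the image of the abelian `Π_a GL_1(R)` under `leviEmbedding`) — the
hypothesis `hM` of the Frobenius core ★ `exists_character_quotient_injective_intertwiningMap_normalizedInd`. [cite: Rogawski1990, §12.1 p. 171] -/
theorem standardLeviGL_id_mul_comm (a b : ↥(standardLeviGL R (id : Fin N → Fin N))) : a * b = b * a := by
  obtain ⟨m, hm⟩ := MonoidHom.mem_range.1 a.2
  obtain ⟨m', hm'⟩ := MonoidHom.mem_range.1 b.2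
  refine Subtype.ext ?_
  change (a : GL (Fin N) R) * b = b * a
  rw [← hm, ← hm', ← map_mul, ← map_mul, levi_id_mul_comm]

end Torus

section LocalField

variable {F : Type*} [Field F] [ValuativeRel F] [TopologicalSpace F] [IsNonarchimedeanLocalField F] {N : ℕ}

/-- **Open subgroups of `GL_N(F)` have countably many cosets** — the hypothesis `hG` of the Frobenius core. [cite: BernsteinZelevinsky1976, 2.11] -/
theorem countable_quotient_of_isOpen_gl (U : Subgroup (GL (Fin N) F)) (hU : IsOpen (U : Set (GL (Fin N) F))) :
    Countable (GL (Fin N) F ⧸ U) :=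
  haveI := K2E3GLnIntegerPointsHaarVsAddHaar.secondCountableTopology_gl (F := F) (N := N)
  Representation.countable_quotient_of_isOpen_of_secondCountableTopology U hU

/-- **Iwasawa decomposition in the Frobenius core's shape**: a compact (indeed compact open) `C ⊆ GL_N(F)` with `GL_N(F) = P_c · C`, for every
block labelling `c` (★ `exists_isCompact_isOpen_forall_standardParabolicGL_mul`). [cite: Bump1997, Prop. 4.5.2] [cite: BernsteinZelevinsky1977, §2.3] -/
theorem exists_isCompact_isOpen_forall_parabolicTripleGL_mul {α : Type*} [LinearOrder α] [Fintype α] (c : Fin N → α) :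
    ∃ K₀ : Subgroup (GL (Fin N) F), IsCompact (K₀ : Set (GL (Fin N) F)) ∧ IsOpen (K₀ : Set (GL (Fin N) F)) ∧
      ∀ g : GL (Fin N) F, ∃ p : ↥(parabolicTripleGL F c).P, ∃ k ∈ (K₀ : Set (GL (Fin N) F)), g = (p : GL (Fin N) F) * k := by
  obtain ⟨K₀, hK₀c, hK₀o, h⟩ := exists_isCompact_isOpen_forall_standardParabolicGL_mul F c
  exact ⟨K₀, hK₀c, hK₀o, fun g => by
    obtain ⟨p, hp, k, hk, hg⟩ := h g
    exact ⟨⟨p, hp⟩, k, hk, hg⟩⟩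

/-- **`δ_{P_c} = 1` on `U_c`** for a monotone labelling `c` (★ `isLimitOfCompactOpen_parabolicTripleGL_N` + ★ `deltaChar_eq_one_of_isLimitOfCompactOpen`) — the
hypothesis `hδ` of the Frobenius core. [cite: BernsteinZelevinsky1977, 1.8, §2.3] -/
theorem deltaChar_parabolicTripleGL_eq_one {α : Type*} [LinearOrder α] [Fintype α] {c : Fin N → α} (hc : Monotone c)
    [LocallyCompactSpace ↥(parabolicTripleGL F c).P] (n : GL (Fin N) F) (hn : n ∈ (parabolicTripleGL F c).N) :
    deltaChar (parabolicTripleGL F c).P ⟨n, (parabolicTripleGL F c).N_le hn⟩ = 1 :=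
  (parabolicTripleGL F c).deltaChar_eq_one_of_isLimitOfCompactOpen (isLimitOfCompactOpen_parabolicTripleGL_N F c hc) n hn

end LocalField

/-! ## §3 Quotient characters of smooth representations have open kernel; `r_{P_c}(π)` is smooth -/

section OpenKernel

variable {M : Type*} [Group M] [TopologicalSpace M] [IsTopologicalGroup M] {W : Type*} [AddCommGroup W] [Module ℂ W]

/-- **A character `χ` of `M` receiving a NON-ZERO `M`-map `ψ : σ → ℂ_χ` from a SMOOTH representation `σ` has open kernel**: if `ψ w ≠ 0` then
`ker χ ⊇ Stab_σ(w)`, which is open (`ψ(σ(m) w) = χ(m) ψ(w)`). [cite: BushnellHenniart2006, §1.1, §9.1] [cite: BernsteinZelevinsky1976, 2.11] -/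
theorem isOpen_ker_of_intertwiningMap_twist_ne_zero {σ : Representation ℂ M W} (hσ : σ.IsSmooth) (χ : M →* ℂˣ)
    (ψ : σ.IntertwiningMap ((Representation.trivial ℂ M ℂ).twist χ)) (hψ : ψ ≠ 0) :
    IsOpen (χ.ker : Set M) := by
  -- a vector on which `ψ` does not vanish
  obtain ⟨w, hw⟩ : ∃ w, ψ w ≠ 0 :=
    not_forall.1 fun h => hψ (Representation.IntertwiningMap.ext (LinearMap.ext fun v => by simpa using h v))
  refine Subgroup.isOpen_mono (H₁ := σ.stabilizerSubgroup w) ?_ (hσ w)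
  intro m hm
  rw [Representation.mem_stabilizerSubgroup] at hm
  rw [MonoidHom.mem_ker]
  have h1 : ψ (σ m w) = (((Representation.trivial ℂ M ℂ).twist χ) m) (ψ w) :=
    Representation.IntertwiningMap.isIntertwining _ _ ψ m w
  rw [hm, Representation.twist_apply, Representation.trivial_apply, smul_eq_mul] at h1
  -- `ψ w = χ m * ψ w` with `ψ w ≠ 0`
  have h2 : ((χ m : ℂˣ) : ℂ) = 1 := (mul_eq_right₀ hw).1 h1.symm
  exact Units.ext h2

variable {F : Type*} [Field F] [ValuativeRel F] [TopologicalSpace F] [IsNonarchimedeanLocalField F] {N : ℕ}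

/-- **The normalised Jacquet module `r_{P_c}(π)` of a smooth `π` is smooth** (monotone `c`): the unnormalised module is smooth (★ `isSmooth_jacquetModule`) and
the normalising character `δ_{P_c}^{-1∕2}|_{M_c}` has open kernel — it is trivial on `M_c ∩ K₀` for the compact open `K₀` of the Iwasawa decomposition
(★ `rootDeltaChar_eq_one_of_mem_of_isClosed_of_isCompact`, `P_c` closed). [cite: BernsteinZelevinsky1977, §1.8, §2.3] [cite: Casselman1995, §3.1] -/
theorem isSmooth_normalizedJacquet_parabolicTripleGL {α : Type*} [LinearOrder α] [Fintype α] (c : Fin N → α)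
    [LocallyCompactSpace ↥(parabolicTripleGL F c).P]
    {V : Type*} [AddCommGroup V] [Module ℂ V] {π : Representation ℂ (GL (Fin N) F) V} (hπ : π.IsSmooth) :
    (π.normalizedJacquet (parabolicTripleGL F c)).IsSmooth := by
  set t := parabolicTripleGL F c with ht
  obtain ⟨K₀, hK₀c, hK₀o, -⟩ := exists_isCompact_isOpen_forall_standardParabolicGL_mul F c
  have hPcl : IsClosed (t.P : Set (GL (Fin N) F)) := isClosed_standardParabolicGL F c
  -- the normalising character is trivial on `M_c ∩ K₀`, an open subgroup of `M_c`
  have hker : IsOpen ((((rootDeltaChar t.P)⁻¹).comp (Subgroup.inclusion t.M_le)).ker : Set t.M) := by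
    refine Subgroup.isOpen_mono (H₁ := K₀.comap t.M.subtype) ?_ (hK₀o.preimage continuous_subtype_val)
    intro m hm
    rw [Subgroup.mem_comap] at hm
    rw [MonoidHom.mem_ker, MonoidHom.comp_apply, MonoidHom.inv_apply,
      rootDeltaChar_eq_one_of_mem_of_isClosed_of_isCompact t.P hPcl hK₀c (p := Subgroup.inclusion t.M_le m) hm, inv_one]
  exact (π.isSmooth_jacquetModule t hπ).twist hker

end OpenKernel

/-! ## §4 The embedding of the principal block into the principal series -/

section Main

variable {F : Type*} [Field F] [ValuativeRel F] [TopologicalSpace F] [IsNonarchimedeanLocalField F] {N : ℕ}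

/-- The inducing character of `normalizedInd (parabolicTripleGL F id) (𝟙 ⊗ χ)` and that of `parabolicIndGL F id (𝟙 ⊗ (χ ∘ leviEmbedding))` AGREE on `B`
(§1: the abstract Levi projection is the block-diagonal part), so the identity of `ℂ` intertwines them. [cite: BernsteinZelevinsky1977, §2.3] -/
theorem twist_comp_proj_apply_eq [LocallyCompactSpace ↥(parabolicTripleGL F (id : Fin N → Fin N)).P]
    (χ : ↥(parabolicTripleGL F (id : Fin N → Fin N)).M →* ℂˣ) (p : ↥(parabolicTripleGL F (id : Fin N → Fin N)).P) (z : ℂ) :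
    (Representation.twist ((((Representation.trivial ℂ _ ℂ).twist χ).comp (parabolicTripleGL F (id : Fin N → Fin N)).proj))
        (rootDeltaChar (parabolicTripleGL F (id : Fin N → Fin N)).P)) p z =
      (Representation.twist ((((Representation.trivial ℂ (Π a : Fin N, GL {i : Fin N // (id : Fin N → Fin N) i = a} F) ℂ).twist
          (χ.comp (leviEmbedding F (id : Fin N → Fin N)).rangeRestrict)).comp (leviProjection F (id : Fin N → Fin N))))
        (rootDeltaChar (standardParabolicGL F (id : Fin N → Fin N)))) p z := by
  simp only [Representation.twist_apply, MonoidHom.coe_comp, Function.comp_apply, Representation.trivial_apply,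
    proj_parabolicTripleGL_eq_rangeRestrict]
  rfl

/-- **BRICK A1 (F-GL) — AN IRREDUCIBLE SMOOTH REPRESENTATION OF `GL_N(F)` WITH NON-ZERO BOREL JACQUET MODULE EMBEDS INTO A PRINCIPAL SERIES.**
For `r₀` irreducible smooth with `¬ Subsingleton (restrictUnipotentGL F id r₀.ρ).Coinvariants` there are a character `χ` of the diagonal torus
`Π_a GL_1(F)` WITH OPEN KERNEL and an INJECTIVE intertwining map `r₀.ρ ↪ parabolicIndGL F id (𝟙 ⊗ χ)` (`χ` is a quotient character of the NORMALISED
Jacquet module `r_B(r₀)`).  Frobenius core ★ at `parabolicTripleGL F id` (§2 hypotheses), open kernel by §3, transport to `parabolicIndGL` by ★ `smoothIndMap`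
of the identity (`twist_comp_proj_apply_eq`). [cite: BernsteinZelevinsky1977, Prop. 1.9 (b), §2.3] [cite: Casselman1995, Thm. 3.2.4] [cite: Rogawski1990, §12.1 pp. 171–172] -/
theorem exists_character_injective_intertwiningMap_parabolicIndGL (r₀ : SmoothIrrep (GL (Fin N) F))
    (hJ : ¬ Subsingleton (Representation.restrictUnipotentGL F (id : Fin N → Fin N) r₀.ρ).Coinvariants) :
    ∃ χ : (Π a : Fin N, GL {i : Fin N // (id : Fin N → Fin N) i = a} F) →* ℂˣ,
      IsOpen (χ.ker : Set (Π a : Fin N, GL {i : Fin N // (id : Fin N → Fin N) i = a} F)) ∧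
      ∃ φ : r₀.ρ.IntertwiningMap (Representation.parabolicIndGL F (id : Fin N → Fin N)
          ((Representation.trivial ℂ (Π a : Fin N, GL {i : Fin N // (id : Fin N → Fin N) i = a} F) ℂ).twist χ)),
        Function.Injective φ := by
  set t := parabolicTripleGL F (id : Fin N → Fin N) with ht
  haveI : LocallyCompactSpace ↥t.P := instLocallyCompactSpaceStandardParabolicGL F id
  haveI : r₀.ρ.IsIrreducible := r₀.isIrreducible
  -- non-vanishing of the abstract Jacquet module (same carrier kernel as `restrictUnipotentGL`, ★ `jacquetGLEquiv`)
  haveI : Nontrivial (Representation.restrictUnipotentGL F (id : Fin N → Fin N) r₀.ρ).Coinvariants := not_subsingleton_iff_nontrivial.1 hJ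
  haveI : Nontrivial (t.restrict r₀.ρ).Coinvariants :=
    (Representation.jacquetGLEquiv F (id : Fin N → Fin N) r₀.ρ).toLinearEquiv.toEquiv.symm.nontrivial
  -- the hypotheses of the Frobenius core
  obtain ⟨K₀, hK₀c, -, hGC⟩ := exists_isCompact_isOpen_forall_parabolicTripleGL_mul (F := F) (id : Fin N → Fin N)
  obtain ⟨χ, ⟨ψ, hψ⟩, f, hf⟩ := r₀.ρ.exists_character_quotient_injective_intertwiningMap_normalizedInd t r₀.isSmooth
    countable_quotient_of_isOpen_gl (deltaChar_parabolicTripleGL_eq_one monotone_id) hK₀c hGC (standardLeviGL_id_mul_comm F)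
  -- the character on `Π_a GL_1(F)`; open kernel
  have hχo : IsOpen (χ.ker : Set ↥t.M) :=
    isOpen_ker_of_intertwiningMap_twist_ne_zero (isSmooth_normalizedJacquet_parabolicTripleGL (id : Fin N → Fin N) r₀.isSmooth) χ ψ hψ
  have hcont : Continuous (leviEmbedding F (id : Fin N → Fin N)).rangeRestrict := by
    refine continuous_induced_rng.2 ?_
    show Continuous fun m => ((leviEmbeddingP F (id : Fin N → Fin N) m : ↥(standardParabolicGL F (id : Fin N → Fin N))) : GL (Fin N) F)
    exact continuous_subtype_val.comp (continuous_leviEmbeddingP F (id : Fin N → Fin N))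
  refine ⟨χ.comp (leviEmbedding F (id : Fin N → Fin N)).rangeRestrict, ?_, ?_⟩
  · have hset : ((χ.comp (leviEmbedding F (id : Fin N → Fin N)).rangeRestrict).ker :
          Set (Π a : Fin N, GL {i : Fin N // (id : Fin N → Fin N) i = a} F)) =
        (leviEmbedding F (id : Fin N → Fin N)).rangeRestrict ⁻¹' (χ.ker : Set ↥t.M) :=
      Set.ext fun _ => Iff.rfl
    rw [hset]
    exact hχo.preimage hcont
  · -- transport along the identity of inducing characters
    let φ₀ : (Representation.twist ((((Representation.trivial ℂ _ ℂ).twist χ).comp t.proj)) (rootDeltaChar t.P)).IntertwiningMap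
        (Representation.twist ((((Representation.trivial ℂ (Π a : Fin N, GL {i : Fin N // (id : Fin N → Fin N) i = a} F) ℂ).twist
          (χ.comp (leviEmbedding F (id : Fin N → Fin N)).rangeRestrict)).comp (leviProjection F (id : Fin N → Fin N))))
          (rootDeltaChar (standardParabolicGL F (id : Fin N → Fin N)))) :=
      { toLinearMap := LinearMap.id
        isIntertwining' := fun p => LinearMap.ext fun z => twist_comp_proj_apply_eq χ p z }
    have hφ₀ : Function.Injective φ₀ := fun a b h => h
    exact ⟨(Representation.smoothIndMap t.P φ₀).comp f, (Representation.smoothIndMap_injective t.P hφ₀).comp hf⟩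

/-- **An irreducible smooth representation of `GL_N(F)` with non-zero Borel Jacquet module is ADMISSIBLE** (★ `isAdmissible_of_nontrivial_coinvariants_of_comm`
at `parabolicTripleGL F id`). [cite: BernsteinZelevinsky1976, §2.25] [cite: BernsteinZelevinsky1977, Prop. 1.9 (b), §2.3] -/
theorem isAdmissible_of_not_subsingleton_coinvariants_id (r₀ : SmoothIrrep (GL (Fin N) F))
    (hJ : ¬ Subsingleton (Representation.restrictUnipotentGL F (id : Fin N → Fin N) r₀.ρ).Coinvariants) :
    r₀.ρ.IsAdmissible := by
  set t := parabolicTripleGL F (id : Fin N → Fin N) with ht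
  haveI : LocallyCompactSpace ↥t.P := instLocallyCompactSpaceStandardParabolicGL F id
  haveI : r₀.ρ.IsIrreducible := r₀.isIrreducible
  haveI : Nontrivial (Representation.restrictUnipotentGL F (id : Fin N → Fin N) r₀.ρ).Coinvariants := not_subsingleton_iff_nontrivial.1 hJ
  haveI : Nontrivial (t.restrict r₀.ρ).Coinvariants :=
    (Representation.jacquetGLEquiv F (id : Fin N → Fin N) r₀.ρ).toLinearEquiv.toEquiv.symm.nontrivial
  obtain ⟨K₀, hK₀c, -, hGC⟩ := exists_isCompact_isOpen_forall_parabolicTripleGL_mul (F := F) (id : Fin N → Fin N)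
  exact r₀.ρ.isAdmissible_of_nontrivial_coinvariants_of_comm t r₀.isSmooth countable_quotient_of_isOpen_gl
    (deltaChar_parabolicTripleGL_eq_one monotone_id) hK₀c hGC (standardLeviGL_id_mul_comm F)

/-- **Class level: every irreducible smooth representation of `GL_N(F)` in the principal block is a CONSTITUENT of a principal series
`parabolicIndGL F id (𝟙 ⊗ χ)`, `χ` with open kernel** (★ `IsConstituentOf.of_injective`). [cite: BernsteinZelevinsky1977, Prop. 1.9 (b), §2.3, Thm. 2.5]
[cite: Rogawski1990, §12.1 pp. 171–172] -/
theorem exists_isConstituentOf_parabolicIndGL_id (r₀ : SmoothIrrep (GL (Fin N) F))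
    (hJ : ¬ Subsingleton (Representation.restrictUnipotentGL F (id : Fin N → Fin N) r₀.ρ).Coinvariants) :
    ∃ χ : (Π a : Fin N, GL {i : Fin N // (id : Fin N → Fin N) i = a} F) →* ℂˣ,
      IsOpen (χ.ker : Set (Π a : Fin N, GL {i : Fin N // (id : Fin N → Fin N) i = a} F)) ∧
      (IrrClass.mk r₀).IsConstituentOf (Representation.parabolicIndGL F (id : Fin N → Fin N)
          ((Representation.trivial ℂ (Π a : Fin N, GL {i : Fin N // (id : Fin N → Fin N) i = a} F) ℂ).twist χ)) := by
  obtain ⟨χ, hχ, φ, hφ⟩ := exists_character_injective_intertwiningMap_parabolicIndGL r₀ hJ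
  exact ⟨χ, hχ, (IrrClass.isConstituentOf_mk_self r₀).of_injective φ hφ⟩

end Main

end Summit.HodgeConjecture.HodgeConjecture.Cruxes.H413.K2E3GLnPrincipalBlockEmbedding

end
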